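import Summits.Ventures.PercRepro.C041ZonePortSwap

/-!
# The zone port problem of THEOREM R: THE LEMMA `0 ≤ Φ∨ P` and `0 ≤ Φ∧ P` in general form (p6, gen 24)

Setting of `C041ZonePortDefs` (mine-3, C-041.md §3 / §6 (a)–(c)): ZONE ports with ARBITRARY terminal-edge
multiplicities and a root set.  For every zone port problem whose zones are reached from the root set, the weight
sums are nonnegative — by strong induction on the number of zones along the gate case analysis: no zone (`Φ = 0`); a
non-switchable gate (case (iii), `C041ZonePortForced`); a gate carrying both terminal types (case (ii),
`C041ZonePortCaseII`); two terminal edges of one side at pure-type gates — at two gates or at ONE gate with several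
edges — or a 1-edge and a 2-edge at pure-type gates of both types (case (iv), `C041ZonePortCaseIVA/B`); a unique
switchable gate zone carrying a SINGLE terminal edge (case (v): `Φ (P.sub C) ≤ Φ P`, `C041ZonePortCaseVSum` /
`C041ZonePortSwap`, and the induction hypothesis on the sub-problem, which has one zone fewer and is reached from its
root zone, `sub_zonesReached`).

* `gate_cases` — the four shapes of a gate zone;
* `phi_nonneg_of_cases` — the induction, once for any weight sum with the case lemmas as hypotheses;
* **`phiOr_nonneg`**, **`phiAnd_nonneg`** — THE LEMMA: `0 ≤ Φ∨ P`, `0 ≤ Φ∧ P` whenever every zone is reached from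
  the root set.

The singleton version (`C041PortProblemLemma`) is the special case of one vertex per zone and at most one edge of
each side; this is the form THEOREM R's reduction for the red-connected-attachment family `𝒮_rc(O)` needs.
-/

namespace PercRepro

namespace ZonePort

namespace Problem

open Finset

variable {V E : Type*}

/-- Without zones there is no terminal edge. -/
theorem not_X₁_of_Z_empty {P : Problem V E} (hZ : P.Z = ∅) (x : P.Term → Bool) : ¬ P.X₁ x := by
  rintro ⟨e, _, _⟩
  exact Finset.eq_empty_iff_forall_notMem.1 hZ _ e.2

/-- Without zones there is no terminal edge. -/
theorem not_X₂_of_Z_empty {P : Problem V E} (hZ : P.Z = ∅) (x : P.Term → Bool) : ¬ P.X₂ x := by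
  rintro ⟨e, _, _⟩
  exact Finset.eq_empty_iff_forall_notMem.1 hZ _ e.2

/-- A Boolean that is not `false` is `true`. -/
theorem Bool.eq_true_of_not_eq_false {b : Bool} (h : ¬ b = false) : b = true := by
  cases b
  · exact absurd rfl h
  · rfl

/-- **The four shapes of a gate zone**: non-switchable; carrying both terminal types; pure type `{1}` with a
1-edge; pure type `{2}` with a 2-edge. -/
theorem gate_cases {P : Problem V E} {C : Finset V} (hC : P.IsGate C) :
    P.sw C = false ∨ (P.sw C = true ∧
      ((∃ e₁ e₂ : P.Term, P.tz e₁.1 = C ∧ P.tz e₂.1 = C ∧ P.ts e₁.1 = false ∧ P.ts e₂.1 = true) ∨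
        (∃ e : P.Term, P.tz e.1 = C ∧ P.ts e.1 = false ∧ P.Pure₁ C) ∨
        (∃ e : P.Term, P.tz e.1 = C ∧ P.ts e.1 = true ∧ P.Pure₂ C))) := by
  by_cases hsw : P.sw C = false
  · exact Or.inl hsw
  right
  refine ⟨Bool.eq_true_of_not_eq_false hsw, ?_⟩
  obtain ⟨e, he⟩ := P.hk C hC.mem
  let e' : P.Term := ⟨e, he ▸ hC.mem⟩
  have he' : P.tz e'.1 = C := he
  by_cases h1 : ∃ f : P.Term, P.tz f.1 = C ∧ P.ts f.1 = false
  · by_cases h2 : ∃ f : P.Term, P.tz f.1 = C ∧ P.ts f.1 = true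
    · obtain ⟨e₁, he₁, hs₁⟩ := h1
      obtain ⟨e₂, he₂, hs₂⟩ := h2
      exact Or.inl ⟨e₁, e₂, he₁, he₂, hs₁, hs₂⟩
    · obtain ⟨e₁, he₁, hs₁⟩ := h1
      refine Or.inr (Or.inl ⟨e₁, he₁, hs₁, fun f hf => ?_⟩)
      cases hs : P.ts f.1
      · rfl
      · exact absurd ⟨f, hf, hs⟩ h2
  · refine Or.inr (Or.inr ⟨e', he', ?_, fun f hf => ?_⟩)
    · cases hs : P.ts e'.1
      · exact absurd ⟨e', he', hs⟩ h1
      · rfl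
    · cases hs : P.ts f.1
      · exact absurd ⟨f, hf, hs⟩ h1
      · rfl

section Induction

variable [Fintype E] [DecidableEq E] [DecidableEq V]

/-- **The gate induction, once for any weight sum `Φ`** given the case lemmas: `Φ ≥ 0` without zones, with a
non-switchable gate, with a two-type gate, with two edges of one side at pure-type gates (distinct edges), with a
1-edge and a 2-edge at pure-type gates of both types, and `Φ (P.sub C) ≤ Φ P` for a unique switchable gate zone
carrying a single edge. -/
theorem phi_nonneg_of_cases (Φ : Problem V E → ℤ)
    (hempty : ∀ P : Problem V E, P.Z = ∅ → 0 ≤ Φ P)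
    (hforced : ∀ (P : Problem V E) (C : Finset V), P.IsGate C → P.sw C = false → 0 ≤ Φ P)
    (htwo : ∀ (P : Problem V E) (C : Finset V), P.IsGate C → ∀ e₁ e₂ : P.Term, P.tz e₁.1 = C → P.tz e₂.1 = C →
      P.ts e₁.1 = false → P.ts e₂.1 = true → 0 ≤ Φ P)
    (hmixed : ∀ (P : Problem V E) (e f : P.Term), P.IsGate (P.tz e.1) → P.IsGate (P.tz f.1) → P.ts e.1 = false →
      P.ts f.1 = true → P.Pure₁ (P.tz e.1) → P.Pure₂ (P.tz f.1) → 0 ≤ Φ P)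
    (hsame₁ : ∀ (P : Problem V E) (e e' : P.Term), P.IsGate (P.tz e.1) → P.IsGate (P.tz e'.1) → P.ts e.1 = false →
      P.ts e'.1 = false → e ≠ e' → P.Pure₁ (P.tz e.1) → P.Pure₁ (P.tz e'.1) → 0 ≤ Φ P)
    (hsame₂ : ∀ (P : Problem V E) (f f' : P.Term), P.IsGate (P.tz f.1) → P.IsGate (P.tz f'.1) → P.ts f.1 = true →
      P.ts f'.1 = true → f ≠ f' → P.Pure₂ (P.tz f.1) → P.Pure₂ (P.tz f'.1) → 0 ≤ Φ P)
    (hsub : ∀ (P : Problem V E) (C : Finset V) (hC : P.IsGate C), (∀ D, P.IsGate D → D = C) → ∀ e₀ : P.Term,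
      P.tz e₀.1 = C → P.ts e₀.1 = false → (∀ f : P.Term, P.tz f.1 = C → f = e₀) → P.sw C = true →
      Φ (P.sub C hC.mem) ≤ Φ P)
    (hsub' : ∀ (P : Problem V E) (C : Finset V) (hC : P.IsGate C), (∀ D, P.IsGate D → D = C) → ∀ e₀ : P.Term,
      P.tz e₀.1 = C → P.ts e₀.1 = true → (∀ f : P.Term, P.tz f.1 = C → f = e₀) → P.sw C = true →
      Φ (P.sub C hC.mem) ≤ Φ P) :
    ∀ (n : ℕ) (P : Problem V E), P.Z.card = n → P.ZonesReached → 0 ≤ Φ P := by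
  intro n
  induction n using Nat.strong_induction_on with
  | _ n ih =>
  intro P hn hconn
  by_cases hZ : P.Z = ∅
  · exact hempty P hZ
  obtain ⟨C, hC⟩ := gates_nonempty hconn (Finset.nonempty_iff_ne_empty.2 hZ)
  -- the induction hypothesis for the sub-problem beyond a unique gate
  have hIH : ∀ (huniq : ∀ D, P.IsGate D → D = C), 0 ≤ Φ (P.sub C hC.mem) := by
    intro huniq
    have hcard : (P.sub C hC.mem).Z.card < n := by
      rw [card_sub_Z hC.mem, hn]
      have : 0 < n := by
        rw [← hn]
        exact Finset.card_pos.2 ⟨C, hC.mem⟩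
      omega
    exact ih _ hcard (P.sub C hC.mem) rfl (sub_zonesReached hC huniq hconn)
  -- a second gate `D ≠ C` settles the case whenever `C` is of pure type with an edge `e`
  have hother : ∀ (e : P.Term), P.tz e.1 = C →
      ((P.ts e.1 = false ∧ P.Pure₁ C) ∨ (P.ts e.1 = true ∧ P.Pure₂ C)) →
      ∀ D, P.IsGate D → D ≠ C → 0 ≤ Φ P := by
    intro e heC he D hD hDC
    have hCe : P.IsGate (P.tz e.1) := heC ▸ hC
    rcases gate_cases hD with hswD | ⟨_, ⟨e₁, e₂, he₁, he₂, hs₁, hs₂⟩ | ⟨f, hfD, hfs, hpD⟩ | ⟨f, hfD, hfs, hpD⟩⟩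
    · exact hforced P D hD hswD
    · exact htwo P D hD e₁ e₂ he₁ he₂ hs₁ hs₂
    · have hfD' : P.IsGate (P.tz f.1) := hfD ▸ hD
      have hne : e ≠ f := fun h => hDC (by rw [← hfD, ← h, heC])
      rcases he with ⟨hes, hpC⟩ | ⟨hes, hpC⟩
      · exact hsame₁ P e f hCe hfD' hes hfs hne (heC ▸ hpC) (hfD ▸ hpD)
      · exact hmixed P f e hfD' hCe hfs hes (hfD ▸ hpD) (heC ▸ hpC)
    · have hfD' : P.IsGate (P.tz f.1) := hfD ▸ hD
      have hne : e ≠ f := fun h => hDC (by rw [← hfD, ← h, heC])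
      rcases he with ⟨hes, hpC⟩ | ⟨hes, hpC⟩
      · exact hmixed P e f hCe hfD' hes hfs (heC ▸ hpC) (hfD ▸ hpD)
      · exact hsame₂ P e f hCe hfD' hes hfs hne (heC ▸ hpC) (hfD ▸ hpD)
  rcases gate_cases hC with hsw | ⟨hsw, ⟨e₁, e₂, he₁, he₂, hs₁, hs₂⟩ | ⟨e, heC, hes, hpC⟩ | ⟨e, heC, hes, hpC⟩⟩
  · exact hforced P C hC hsw
  · exact htwo P C hC e₁ e₂ he₁ he₂ hs₁ hs₂
  · -- pure type `{1}` with the 1-edge `e`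
    have hCe : P.IsGate (P.tz e.1) := heC ▸ hC
    by_cases hf : ∃ f : P.Term, P.tz f.1 = C ∧ f ≠ e
    · obtain ⟨f, hfC, hfe⟩ := hf
      exact hsame₁ P e f hCe (hfC ▸ hC) hes (hpC f hfC) (Ne.symm hfe) (heC ▸ hpC) (hfC ▸ hpC)
    · have huniqT : ∀ f : P.Term, P.tz f.1 = C → f = e := fun f hfC => by
        by_contra h
        exact hf ⟨f, hfC, h⟩
      by_cases huniq : ∀ D, P.IsGate D → D = C
      · exact le_trans (hIH huniq) (hsub P C hC huniq e heC hes huniqT hsw)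
      · obtain ⟨D, hD⟩ := not_forall.1 huniq
        obtain ⟨hD, hDC⟩ := Classical.not_imp.1 hD
        exact hother e heC (Or.inl ⟨hes, hpC⟩) D hD hDC
  · -- pure type `{2}` with the 2-edge `e`
    have hCe : P.IsGate (P.tz e.1) := heC ▸ hC
    by_cases hf : ∃ f : P.Term, P.tz f.1 = C ∧ f ≠ e
    · obtain ⟨f, hfC, hfe⟩ := hf
      exact hsame₂ P e f hCe (hfC ▸ hC) hes (hpC f hfC) (Ne.symm hfe) (heC ▸ hpC) (hfC ▸ hpC)
    · have huniqT : ∀ f : P.Term, P.tz f.1 = C → f = e := fun f hfC => by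
        by_contra h
        exact hf ⟨f, hfC, h⟩
      by_cases huniq : ∀ D, P.IsGate D → D = C
      · exact le_trans (hIH huniq) (hsub' P C hC huniq e heC hes huniqT hsw)
      · obtain ⟨D, hD⟩ := not_forall.1 huniq
        obtain ⟨hD, hDC⟩ := Classical.not_imp.1 hD
        exact hother e heC (Or.inr ⟨hes, hpC⟩) D hD hDC

open Classical in
/-- No zone: `Φ∨ = 0`. -/
theorem phiOr_nonneg_of_Z_empty {P : Problem V E} (hZ : P.Z = ∅) : 0 ≤ P.phiOr := by
  unfold phiOr
  apply Finset.sum_nonneg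
  intro x _
  rw [if_neg (fun h => h.2.elim (not_X₁_of_Z_empty hZ x) (not_X₂_of_Z_empty hZ x))]

open Classical in
/-- No zone: `Φ∧ = 0`. -/
theorem phiAnd_nonneg_of_Z_empty {P : Problem V E} (hZ : P.Z = ∅) : 0 ≤ P.phiAnd := by
  unfold phiAnd
  apply Finset.sum_nonneg
  intro x _
  rw [if_neg (fun h => not_X₁_of_Z_empty hZ x h.2.1)]

/-- **THE LEMMA (mine-3, C-041.md §3 / §6 (b)), `Φ∨`, general form**: on every zone port problem whose zones are
reached from the root set, `0 ≤ Φ∨ P`. -/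
theorem phiOr_nonneg (P : Problem V E) (hconn : P.ZonesReached) : 0 ≤ P.phiOr :=
  phi_nonneg_of_cases phiOr (fun _ h => phiOr_nonneg_of_Z_empty h)
    (fun _ _ hC hsw => phiOr_nonneg_of_forced_gate hC hsw)
    (fun _ _ hC _ _ he₁ he₂ hs₁ hs₂ => phiOr_nonneg_of_twoType_gate hC he₁ he₂ hs₁ hs₂)
    (fun _ _ _ hCe hCf he hf hpe hpf => phiOr_nonneg_of_pure_gates_mixed hCe hCf he hf hpe hpf)
    (fun _ _ _ hCe hCe' he he' hne hpe hpe' => phiOr_nonneg_of_pure_gates_same₁ hCe hCe' he he' hne hpe hpe')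
    (fun _ _ _ hCf hCf' hf hf' hne hpf hpf' => phiOr_nonneg_of_pure_gates_same₂ hCf hCf' hf hf' hne hpf hpf')
    (fun _ _ hC huniq _ he₀ hs₀ huniqT hsw => phiOr_sub_le hC huniq he₀ hs₀ huniqT hsw)
    (fun _ _ hC huniq _ he₀ hs₀ huniqT hsw => phiOr_sub_le' hC huniq he₀ hs₀ huniqT hsw)
    _ P rfl hconn

/-- **THE LEMMA, `Φ∧`, general form**: on every zone port problem whose zones are reached from the root set,
`0 ≤ Φ∧ P`. -/
theorem phiAnd_nonneg (P : Problem V E) (hconn : P.ZonesReached) : 0 ≤ P.phiAnd :=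
  phi_nonneg_of_cases phiAnd (fun _ h => phiAnd_nonneg_of_Z_empty h)
    (fun _ _ hC hsw => phiAnd_nonneg_of_forced_gate hC hsw)
    (fun _ _ hC _ _ he₁ he₂ hs₁ hs₂ => phiAnd_nonneg_of_twoType_gate hC he₁ he₂ hs₁ hs₂)
    (fun _ _ _ hCe hCf he hf hpe hpf => phiAnd_nonneg_of_pure_gates_mixed hCe hCf he hf hpe hpf)
    (fun _ _ _ hCe hCe' he he' hne hpe hpe' => phiAnd_nonneg_of_pure_gates_same₁ hCe hCe' he he' hne hpe hpe')
    (fun _ _ _ hCf hCf' hf hf' hne hpf hpf' => phiAnd_nonneg_of_pure_gates_same₂ hCf hCf' hf hf' hne hpf hpf')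
    (fun _ _ hC huniq _ he₀ hs₀ huniqT hsw => phiAnd_sub_le hC huniq he₀ hs₀ huniqT hsw)
    (fun _ _ hC huniq _ he₀ hs₀ huniqT hsw => phiAnd_sub_le' hC huniq he₀ hs₀ huniqT hsw)
    _ P rfl hconn

end Induction

end Problem

end ZonePort

end PercRepro
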